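import Literature.Computability.QuantumComplexity.ApproxMatrixProduct
import Literature.Computability.Complexity.MedianOfMeans
import HarnessLib

/-!
# Concentration of the Frobenius norm of an importance-sampling sketch (CGLLTW 2022, Lemma 5.1)

Chia, Gilyén, Li, Lin, Tang, Wang, *Sampling-based sublinear low-rank matrix arithmetic framework
for dequantizing quantum machine learning*, J. ACM 69(5):33 (2022) = arXiv:1910.06151, §5.2
"Sketching matrices and technical tools" (numbering of the held arXiv text):

> **Lemma 5.1 (Frobenius norm bounds for matrix sketches).** Given `A ∈ ℂ^{m×n}`, let
> `S ∈ ℝ^{r×m}` be sampled according to `p ∈ ℝ^m`, a `φ`-oversampled importance sampling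
> distribution from `A`. Then `‖SA‖_F² ≤ φ‖A‖_F²` (always) and
> `Pr[ |‖SA‖_F² − ‖A‖_F²| ≥ √(φ² log(2/δ)/(2r)) ‖A‖_F² ] ≤ δ`.
>
> *Proof.* `‖SA‖_F²` is the average of the norms of `r‖[SA](i,·)‖²` for rows `i ∈ [r]` and
> `E[r‖[SA](i,·)‖²] = r Σ_{s=1}^m p(s) ‖A(s,·)‖²/(r p(s)) = ‖A‖_F²`,
> `r‖[SA](i,·)‖² = ‖A(s_i,·)‖²/p(s_i) ≤ φ‖A‖_F²`. Note that the second inequality implies that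
> `‖SA‖_F² ≤ φ‖A‖_F²`. The other inequality in the theorem statement follows by Hoeffding's
> inequality. □

Transcription note on the displayed tail bound [R-SNC-1]: in the held arXiv TeX source (p. 35,
L77) the absolute-value macro is stripped and the relation inside the event is printed literally
as `\leq`, i.e. the display reads `Pr[ ‖SA‖_F² − ‖A‖_F² \leq √(φ² log(2/δ)/2r) ‖A‖_F² ] ≤ δ`; the
quotation above restores the bars and the tail direction `≥`, which is the statement that the
printed proof ("follows by Hoeffding's inequality") establishes and the one proved in this file
(`iid_mass_abs_frobSq_sketch_sub_ge_le`).  The J. ACM version was not available for comparison.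

`ApproxMatrixProduct.lean` proves the deterministic clause (`frobSq_sketch_mul_le`), the mean
(`iid_frobSq_sketch_mul`) and the pointwise bound (`normSq_sketch_mul_row_le`), and lists "the
Hoeffding half of Lemma 5.1" as not formalized there.  This file supplies it, in the same finite
language — sample sequences `ω ∈ [m]^r` weighted by `iidWeight p ω = ∏_i p(ω_i)`, `Pr[E]` the
`iidWeight`-mass of `E` — from the weighted Hoeffding inequality for `[0,1]`-valued summands of
`MedianOfMeans.lean` (`sum_weight_upperDeviation_le_exp` / `sum_weight_lowerDeviation_le_exp`,
[Hoeffding1963, Thm. 2]) applied to the summand `F(k) = ‖A(k,·)‖²/(p(k)·φ‖A‖_F²) ∈ [0,1]`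
(`normSq_row_div_le`), whose `p`-mean is `1/φ` (`sum_mul_normSq_row_div`, the displayed
expectation) and whose sample sum is `r‖SA‖_F²/(φ‖A‖_F²)` (`sum_normSq_row_div_eq`, the
displayed "average"): the two one-sided tails `Pr[±(‖SA‖_F² − ‖A‖_F²) ≥ ηφ‖A‖_F²] ≤ exp(−2rη²)`
(`iid_mass_frobSq_sketch_sub_ge_le_exp`, `iid_mass_sub_frobSq_sketch_ge_le_exp`) and, with
`η = √(log(2/δ)/(2r))`, the printed two-sided statement (`iid_mass_abs_frobSq_sketch_sub_ge_le`;
Lemma 5.1 assembled: `frobenius_norm_bounds`).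

Conventions as in `ApproxMatrixProduct.lean`: real entries (`-- TODO(general form): ℂ entries`;
only the row norms `‖A(k,·)‖²` enter), `r = s` samples, `A = X : Matrix (Fin m) (Fin n) ℝ`.  The
hypothesis `X ≠ 0` is needed (for `X = 0` the printed event is `0 ≥ 0`, of mass `1 > δ`; Def. 2.7
presupposes `X ≠ 0`), and `δ > 0` is arbitrary (for `δ ≥ 1` the bound is trivial).  No named
facts; everything stated is proved.

## References
* [ChiaEtAl2022] N.-H. Chia, A. Gilyén, T. Li, H.-H. Lin, E. Tang, C. Wang, J. ACM 69(5):33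
  (2022) = arXiv:1910.06151, §5.2 Lemma 5.1 "Frobenius norm bounds for matrix sketches" and its
  proof (held text p. 35).
* [Hoeffding1963] W. Hoeffding, J. Amer. Statist. Assoc. 58 (1963) 13–30, Thm. 2 — via
  `Literature.Computability.Complexity.sum_weight_upperDeviation_le_exp`.
-/

noncomputable section

namespace Literature.Computability.QuantumComplexity

namespace SampleQuery

open Finset Real Literature.Computability.Complexity

open scoped Matrix

variable {m n s : ℕ} {φ : ℝ} {X : Matrix (Fin m) (Fin n) ℝ} {p : Fin m → ℝ}

/-- `‖X‖_F² > 0` for `X ≠ 0`. [cite: ChiaEtAl2022, §2.1 notation] -/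
theorem frobSq_pos (hX : X ≠ 0) : 0 < frobSq X := by
  obtain ⟨i, hi⟩ : ∃ i, X i ≠ 0 := Function.ne_iff.mp hX
  exact lt_of_lt_of_le (normSq_pos hi)
    (Finset.single_le_sum (f := fun i => normSq (X i)) (fun i _ => normSq_nonneg _)
      (Finset.mem_univ i))

/-- **The Hoeffding summand is `[0,1]`-valued**: `0 ≤ ‖X(k,·)‖²/(p(k) φ‖X‖_F²) ≤ 1`
("`r‖[SA](i,·)‖² = ‖A(s_i,·)‖²/p(s_i) ≤ φ‖A‖_F²`"). [cite: ChiaEtAl2022, §5.2, proof of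
Lemma 5.1] -/
theorem normSq_row_div_div_mem_Icc (h : IsOversampledDist φ (rowNorms X) p) (hφ : 0 < φ)
    (hX : X ≠ 0) (k : Fin m) :
    normSq (X k) / p k / (φ * frobSq X) ∈ Set.Icc (0 : ℝ) 1 := by
  have hφF : 0 < φ * frobSq X := mul_pos hφ (frobSq_pos hX)
  exact ⟨div_nonneg (div_nonneg (normSq_nonneg _) (h.nonneg k)) hφF.le,
    (div_le_one hφF).2 (h.normSq_row_div_le hφ k)⟩

/-- **Mean of the summand**: `Σ_k p(k) · ‖X(k,·)‖²/(p(k) φ‖X‖_F²) = 1/φ` (printed: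
"`E[r‖[SA](i,·)‖²] = r Σ_s p(s)‖A(s,·)‖²/(r p(s)) = ‖A‖_F²`"; indices of mass zero carry zero
rows, `IsOversampledDist.row_eq_zero`). [cite: ChiaEtAl2022, §5.2, proof of Lemma 5.1] -/
theorem sum_mul_normSq_row_div (h : IsOversampledDist φ (rowNorms X) p) (hφ : 0 < φ)
    (hX : X ≠ 0) : ∑ k, p k * (normSq (X k) / p k / (φ * frobSq X)) = 1 / φ := by
  have hF : 0 < frobSq X := frobSq_pos hX
  have hterm : ∀ k, p k * (normSq (X k) / p k / (φ * frobSq X)) =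
      normSq (X k) / (φ * frobSq X) := by
    intro k
    rcases eq_or_ne (p k) 0 with h0 | h0
    · rw [h0, zero_mul, h.row_eq_zero hφ h0, (normSq_eq_zero_iff _).2 rfl, zero_div]
    · field_simp
  simp_rw [hterm, ← Finset.sum_div]
  show frobSq X / (φ * frobSq X) = 1 / φ
  field_simp

/-- **Sample sum of the summand**: `Σ_i ‖X(ω_i,·)‖²/(p(ω_i) c) = s‖SX‖_F²/c` ("`‖SA‖_F²` is the
average of … `r‖[SA](i,·)‖²`", `r‖[SA](i,·)‖² = ‖A(s_i,·)‖²/p(s_i)`).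
[cite: ChiaEtAl2022, §5.2, proof of Lemma 5.1] -/
theorem sum_normSq_row_div_eq (hp : ∀ k, 0 ≤ p k) (hs : s ≠ 0) (ω : Fin s → Fin m) (c : ℝ) :
    ∑ t, normSq (X (ω t)) / p (ω t) / c = s * frobSq (sketch p ω * X) / c := by
  have hs' : (s : ℝ) ≠ 0 := Nat.cast_ne_zero.2 hs
  unfold frobSq
  rw [Finset.mul_sum, Finset.sum_div]
  refine Finset.sum_congr rfl fun t _ => ?_
  rw [normSq_sketch_mul_row hp]
  rcases eq_or_ne (p (ω t)) 0 with h0 | h0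
  · simp [h0]
  · field_simp

/-- **Upper tail** (Hoeffding's parametrisation): for `η ≥ 0` the `p`-mass of
`{ω : ηφ‖X‖_F² ≤ ‖SX‖_F² − ‖X‖_F²}` is at most `exp(−2sη²)` ("follows by Hoeffding's
inequality"). [cite: ChiaEtAl2022, Lemma 5.1 (second clause) and its proof] -/
theorem iid_mass_frobSq_sketch_sub_ge_le_exp (h : IsOversampledDist φ (rowNorms X) p)
    (hφ : 0 < φ) (hX : X ≠ 0) (hs : 0 < s) {η : ℝ} (hη : 0 ≤ η) :
    ∑ ω ∈ univ.filter (fun ω : Fin s → Fin m =>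
        η * φ * frobSq X ≤ frobSq (sketch p ω * X) - frobSq X), iidWeight p ω
      ≤ exp (-2 * s * η ^ 2) := by
  have hF : 0 < frobSq X := frobSq_pos hX
  have hφF : 0 < φ * frobSq X := mul_pos hφ hF
  set F : Fin m → ℝ := fun k => normSq (X k) / p k / (φ * frobSq X) with hFdef
  have hF01 : ∀ k, F k ∈ Set.Icc (0 : ℝ) 1 := fun k => normSq_row_div_div_mem_Icc h hφ hX k
  have hmean : ∑ k, p k * F k = 1 / φ := sum_mul_normSq_row_div h hφ hX
  have hH : ∑ ω ∈ univ.filter (fun ω : Fin s → Fin m =>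
      (s : ℝ) * η ≤ (∑ i, F (ω i)) - s * (∑ a, p a * F a)), iidWeight p ω
        ≤ exp (-2 * s * η ^ 2) :=
    sum_weight_upperDeviation_le_exp p h.nonneg h.sum_eq_one F hF01 hs hη
  refine le_trans (Finset.sum_le_sum_of_subset_of_nonneg (fun ω hω => ?_)
    (fun ω _ _ => iidWeight_nonneg h.nonneg ω)) hH
  rw [Finset.mem_filter] at hω ⊢
  refine ⟨Finset.mem_univ _, ?_⟩
  have hsum : ∑ i, F (ω i) = s * frobSq (sketch p ω * X) / (φ * frobSq X) :=
    sum_normSq_row_div_eq h.nonneg hs.ne' ω _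
  rw [hmean, hsum]
  have hdev : η ≤ (frobSq (sketch p ω * X) - frobSq X) / (φ * frobSq X) := by
    rw [le_div_iff₀ hφF]; linarith [hω.2]
  have heq : (s : ℝ) * frobSq (sketch p ω * X) / (φ * frobSq X) - s * (1 / φ) =
      s * ((frobSq (sketch p ω * X) - frobSq X) / (φ * frobSq X)) := by
    field_simp
  rw [heq]
  exact mul_le_mul_of_nonneg_left hdev (Nat.cast_nonneg _)

/-- **Lower tail**: for `η ≥ 0` the `p`-mass of `{ω : ηφ‖X‖_F² ≤ ‖X‖_F² − ‖SX‖_F²}` is at most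
`exp(−2sη²)`. [cite: ChiaEtAl2022, Lemma 5.1 (second clause) and its proof] -/
theorem iid_mass_sub_frobSq_sketch_ge_le_exp (h : IsOversampledDist φ (rowNorms X) p)
    (hφ : 0 < φ) (hX : X ≠ 0) (hs : 0 < s) {η : ℝ} (hη : 0 ≤ η) :
    ∑ ω ∈ univ.filter (fun ω : Fin s → Fin m =>
        η * φ * frobSq X ≤ frobSq X - frobSq (sketch p ω * X)), iidWeight p ω
      ≤ exp (-2 * s * η ^ 2) := by
  have hF : 0 < frobSq X := frobSq_pos hX
  have hφF : 0 < φ * frobSq X := mul_pos hφ hF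
  set F : Fin m → ℝ := fun k => normSq (X k) / p k / (φ * frobSq X) with hFdef
  have hF01 : ∀ k, F k ∈ Set.Icc (0 : ℝ) 1 := fun k => normSq_row_div_div_mem_Icc h hφ hX k
  have hmean : ∑ k, p k * F k = 1 / φ := sum_mul_normSq_row_div h hφ hX
  have hH : ∑ ω ∈ univ.filter (fun ω : Fin s → Fin m =>
      (s : ℝ) * η ≤ s * (∑ a, p a * F a) - (∑ i, F (ω i))), iidWeight p ω
        ≤ exp (-2 * s * η ^ 2) :=
    sum_weight_lowerDeviation_le_exp p h.nonneg h.sum_eq_one F hF01 hs hη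
  refine le_trans (Finset.sum_le_sum_of_subset_of_nonneg (fun ω hω => ?_)
    (fun ω _ _ => iidWeight_nonneg h.nonneg ω)) hH
  rw [Finset.mem_filter] at hω ⊢
  refine ⟨Finset.mem_univ _, ?_⟩
  have hsum : ∑ i, F (ω i) = s * frobSq (sketch p ω * X) / (φ * frobSq X) :=
    sum_normSq_row_div_eq h.nonneg hs.ne' ω _
  rw [hmean, hsum]
  have hdev : η ≤ (frobSq X - frobSq (sketch p ω * X)) / (φ * frobSq X) := by
    rw [le_div_iff₀ hφF]; linarith [hω.2]
  have heq : (s : ℝ) * (1 / φ) - s * frobSq (sketch p ω * X) / (φ * frobSq X) =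
      s * ((frobSq X - frobSq (sketch p ω * X)) / (φ * frobSq X)) := by
    field_simp
  rw [heq]
  exact mul_le_mul_of_nonneg_left hdev (Nat.cast_nonneg _)

/-- **CGLLTW Lemma 5.1, second clause, as printed**:
`Pr[ |‖SX‖_F² − ‖X‖_F²| ≥ √(φ² log(2/δ)/(2s)) ‖X‖_F² ] ≤ δ` — the `p`-mass of the sample
sequences `ω ∈ [m]^s` in that event is at most `δ` (`s ≥ 1`, `δ > 0`, `X ≠ 0`).
[cite: ChiaEtAl2022, Lemma 5.1 (second clause)] -/
theorem iid_mass_abs_frobSq_sketch_sub_ge_le (h : IsOversampledDist φ (rowNorms X) p)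
    (hφ : 0 < φ) (hX : X ≠ 0) (hs : 0 < s) {δ : ℝ} (hδ : 0 < δ) :
    ∑ ω ∈ univ.filter (fun ω : Fin s → Fin m =>
        Real.sqrt (φ ^ 2 * Real.log (2 / δ) / (2 * s)) * frobSq X ≤
          |frobSq (sketch p ω * X) - frobSq X|), iidWeight p ω ≤ δ := by
  rcases le_or_gt 1 δ with hδ1 | hδ1
  · calc _ ≤ ∑ ω, iidWeight p ω :=
          Finset.sum_le_sum_of_subset_of_nonneg (Finset.filter_subset _ _)
            (fun ω _ _ => iidWeight_nonneg h.nonneg ω)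
      _ = 1 := sum_iidWeight h.sum_eq_one
      _ ≤ δ := hδ1
  have hs' : (0 : ℝ) < s := Nat.cast_pos.2 hs
  have hL : 0 < Real.log (2 / δ) := Real.log_pos (by rw [lt_div_iff₀ hδ]; linarith)
  have hL' : 0 ≤ Real.log (2 / δ) / (2 * s) := div_nonneg hL.le (by positivity)
  set η : ℝ := Real.sqrt (Real.log (2 / δ) / (2 * s)) with hηdef
  have hη : 0 ≤ η := Real.sqrt_nonneg _
  have hthr : Real.sqrt (φ ^ 2 * Real.log (2 / δ) / (2 * s)) = η * φ := by
    rw [hηdef, show φ ^ 2 * Real.log (2 / δ) / (2 * s) = Real.log (2 / δ) / (2 * s) * φ ^ 2 by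
      ring, Real.sqrt_mul hL', Real.sqrt_sq hφ.le]
  have hexp : exp (-2 * s * η ^ 2) = δ / 2 := by
    rw [hηdef, Real.sq_sqrt hL', show -2 * (s : ℝ) * (Real.log (2 / δ) / (2 * s)) =
      -Real.log (2 / δ) by field_simp, Real.exp_neg, Real.exp_log (by positivity), inv_div]
  set U := univ.filter (fun ω : Fin s → Fin m =>
    η * φ * frobSq X ≤ frobSq (sketch p ω * X) - frobSq X) with hU
  set L := univ.filter (fun ω : Fin s → Fin m =>
    η * φ * frobSq X ≤ frobSq X - frobSq (sketch p ω * X)) with hLset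
  have hsub : univ.filter (fun ω : Fin s → Fin m =>
      Real.sqrt (φ ^ 2 * Real.log (2 / δ) / (2 * s)) * frobSq X ≤
        |frobSq (sketch p ω * X) - frobSq X|) ⊆ U ∪ L := by
    intro ω hω
    rw [Finset.mem_filter, hthr] at hω
    rw [Finset.mem_union, hU, hLset, Finset.mem_filter, Finset.mem_filter]
    rcases le_abs'.1 hω.2 with h1 | h1
    · exact Or.inr ⟨Finset.mem_univ _, by linarith⟩
    · exact Or.inl ⟨Finset.mem_univ _, h1⟩
  have hul : ∑ ω ∈ U ∪ L, iidWeight p ω ≤ ∑ ω ∈ U, iidWeight p ω + ∑ ω ∈ L, iidWeight p ω := by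
    rw [← Finset.sum_union_inter]
    exact le_add_of_nonneg_right (Finset.sum_nonneg fun ω _ => iidWeight_nonneg h.nonneg ω)
  calc _ ≤ ∑ ω ∈ U ∪ L, iidWeight p ω :=
        Finset.sum_le_sum_of_subset_of_nonneg hsub (fun ω _ _ => iidWeight_nonneg h.nonneg ω)
    _ ≤ ∑ ω ∈ U, iidWeight p ω + ∑ ω ∈ L, iidWeight p ω := hul
    _ ≤ exp (-2 * s * η ^ 2) + exp (-2 * s * η ^ 2) :=
        add_le_add (iid_mass_frobSq_sketch_sub_ge_le_exp h hφ hX hs hη)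
          (iid_mass_sub_frobSq_sketch_ge_le_exp h hφ hX hs hη)
    _ = δ := by rw [hexp]; ring

/-- **CGLLTW Lemma 5.1 assembled (Frobenius norm bounds for matrix sketches)**: for `S` sampled
according to a `φ`-oversampled importance sampling distribution `p` from `X ≠ 0` (`s ≥ 1` rows),
`‖SX‖_F² ≤ φ‖X‖_F²` always, and
`Pr[ |‖SX‖_F² − ‖X‖_F²| ≥ √(φ² log(2/δ)/(2s)) ‖X‖_F² ] ≤ δ` for every `δ > 0`.
[cite: ChiaEtAl2022, Lemma 5.1] -/
theorem frobenius_norm_bounds (h : IsOversampledDist φ (rowNorms X) p) (hφ : 0 < φ)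
    (hX : X ≠ 0) (hs : 0 < s) :
    (∀ ω : Fin s → Fin m, frobSq (sketch p ω * X) ≤ φ * frobSq X) ∧
    ∀ δ : ℝ, 0 < δ →
      ∑ ω ∈ univ.filter (fun ω : Fin s → Fin m =>
          Real.sqrt (φ ^ 2 * Real.log (2 / δ) / (2 * s)) * frobSq X ≤
            |frobSq (sketch p ω * X) - frobSq X|), iidWeight p ω ≤ δ :=
  ⟨fun ω => frobSq_sketch_mul_le h hφ ω,
    fun _ hδ => iid_mass_abs_frobSq_sketch_sub_ge_le h hφ hX hs hδ⟩

end SampleQuery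

end Literature.Computability.QuantumComplexity

end
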